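import Summits.Ventures.PercRepro.Night2SeriesTriangle
import Summits.Ventures.PercRepro.Night2FatBudgetFSCells

/-!
# PercRepro — **THE `(7, 5)` CELL `(3, 0)` AT `|G| = 10` CLOSES OUTRIGHT**; residues N (night-2, gen 23)

Given a fat thin member (the residue's «fat 6/2»), the cell `(3, 0)` at `|G| = 10` closes for every `G`:
* at most four fat thin closures — the fat-face budget cells of `Night2FatBudgetCells` (one closure: `1.546`; two
  different missed sets with `≤ 4` closures: `1.029`);
* at least five — three fat thin members with pairwise different missed sets; if two of the missed pairs share a
  point `p`, series transitivity (`eRk_sdiff_pair_le_of_series`) supplies the third hyperplane of the triangle and the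
  triangle count closes (`localShadowHall_three_zero_six_ten_of_triangle`, count sum `18934/18655 = 1.015` with the
  chord `41/120`); otherwise the three missed pairs are pairwise disjoint and `Night2ThreeFatCellsB` closes
  (`1.022`).

**`localShadowHall_three_zero_six_ten`** is the second `(3, 0)` cell closed with no clause (after `|G| = 13`), and
**`shadowHall_seven_five_of_residuesN`** shrinks the `(3, 0)` range of the `(7, 5)` shadow row to `11 ≤ |G| ≤ 12`.
-/

namespace PercRepro.Shadow

open Finset PerFlat ThmH

/-- The count sum of the cell `(3, 0)` at `n = 10` with the triangle count and the chord `E = 41/120`: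
`18934/18655 = 1.015 ≥ 1`. -/
theorem countSum_three_zero_ten_tri :
    1 ≤ countSum 10 6 3 (cPrimeDGP 5 3 6 0 2) (41 / 120 : ℚ) (cntTriangle 6) := by
  rw [cPrimeDGP_three_zero_two]
  unfold countSum DGenP.cjG cntTriangle
  rw [show Finset.Icc 1 (10 - 6) = {1, 2, 3, 4} by decide]
  repeat rw [Finset.sum_insert (by decide)]
  rw [Finset.sum_singleton]
  norm_num [Nat.choose_eq_descFactorial_div_factorial, Nat.descFactorial, Nat.factorial]

variable {α : Type*} [DecidableEq α]

/-- Two different pairs sharing a point are `{p, x}` and `{p, y}` with `p, x, y` distinct. -/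
theorem pair_shape_of_mem_inter {P₀ P₁ : Finset α} (h₀ : P₀.card = 2) (h₁ : P₁.card = 2) (hne : P₀ ≠ P₁)
    {p : α} (hp : p ∈ P₀ ∩ P₁) :
    ∃ x y, P₀ = {p, x} ∧ P₁ = {p, y} ∧ p ≠ x ∧ p ≠ y ∧ x ≠ y := by
  rw [Finset.mem_inter] at hp
  obtain ⟨u, v, huv, rfl⟩ := Finset.card_eq_two.1 h₀
  obtain ⟨u', v', huv', rfl⟩ := Finset.card_eq_two.1 h₁
  have hx : ∃ x, ({u, v} : Finset α) = {p, x} ∧ p ≠ x := by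
    rcases Finset.mem_insert.1 hp.1 with rfl | h
    · exact ⟨v, rfl, huv⟩
    · rw [Finset.mem_singleton] at h
      subst h
      exact ⟨u, Finset.pair_comm u p, fun h => huv h.symm⟩
  have hy : ∃ y, ({u', v'} : Finset α) = {p, y} ∧ p ≠ y := by
    rcases Finset.mem_insert.1 hp.2 with rfl | h
    · exact ⟨v', rfl, huv'⟩
    · rw [Finset.mem_singleton] at h
      subst h
      exact ⟨u', Finset.pair_comm u' p, fun h => huv' h.symm⟩
  obtain ⟨x, hx, hpx⟩ := hx
  obtain ⟨y, hy, hpy⟩ := hy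
  refine ⟨x, y, hx, hy, hpx, hpy, ?_⟩
  intro hxy
  apply hne
  rw [hx, hy, hxy]

variable {M : Matroid α} [M.Finite]

open scoped Classical in
/-- **The cell `(3, 0)` at `|G| = 10` with two fat thin members whose missed pairs share a point**: (LI_G) through
series transitivity and the triangle count. -/
theorem localShadowHall_three_zero_six_ten_of_triangle {G : Finset α} (hG : G ∈ flatsQ M (5 + 1))
    (hd : (gr M \ G).card = 3) (hk : kColoops M G = 0)
    (hs : ∀ e ∈ gr M, ∀ f ∈ gr M, e ≠ f → rkN M {e, f} = 2) (hl : ∀ e ∈ gr M, M.Indep {e})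
    (hn : G.card = 10) {B₀ B₁ : Finset α} (hB₀ : B₀ ∈ thinMembers M 5 G) (hB₁ : B₁ ∈ thinMembers M 5 G)
    {p x y : α} (hP₀ : G \ clF M B₀ = {p, x}) (hP₁ : G \ clF M B₁ = {p, y})
    (hpx : p ≠ x) (hpy : p ≠ y) (hxy : x ≠ y) :
    LocalShadowHall M 5 G := by
  have hk' : kColoops M G + 6 = 5 + 1 := by omega
  have hd' : (gr M \ G).card ≤ 5 := by omega
  have hm2 : ∀ B ∈ thinMembers M 5 G, 6 ≤ (B \ coloops M G).card → 2 ≤ (G \ clF M B).card :=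
    fun B hB _ => two_le_card_sdiff_of_not_lay0 hG hd' (mem_thinMembers.1 hB).1 (mem_thinMembers.1 hB).2
  have hc2 : 0 ≤ cPrimeDGP 5 3 6 (kColoops M G) 2 := by
    rw [hk]; unfold cPrimeDGP capDG reqDGP phiQ; norm_num
  have hn' : G.card - kColoops M G = 10 := by omega
  have hKG : coloops M G ⊆ G := fun y hy => (mem_coloops.1 hy).1
  have hnK : (G \ coloops M G).card = 10 := by
    rw [Finset.card_sdiff_of_subset hKG, ← kColoops_eq_card_coloops]; omega
  have hKempty : coloops M G = ∅ := by
    rw [kColoops_eq_card_coloops] at hk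
    exact Finset.card_eq_zero.1 hk
  -- the third hyperplane of the triangle
  have hH₀ := eRk_clF_le_of_mem_thinMembers hB₀
  have hH₁ := eRk_clF_le_of_mem_thinMembers hB₁
  have hH₂ : M.eRk ((G \ {x, y} : Finset α) : Set α) ≤ ((5 : ℕ) : ℕ∞) :=
    eRk_sdiff_pair_le_of_series hG hk hH₀ hH₁ hP₀ hP₁ hpx hpy hxy
  have hxG : x ∈ G := by
    have : x ∈ G \ clF M B₀ := by rw [hP₀]; simp
    exact (Finset.mem_sdiff.1 this).1
  have hyG : y ∈ G := by
    have : y ∈ G \ clF M B₁ := by rw [hP₁]; simp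
    exact (Finset.mem_sdiff.1 this).1
  have hP₂ : G \ (G \ {x, y}) = {x, y} :=
    Finset.sdiff_sdiff_eq_self (Finset.insert_subset hxG (Finset.singleton_subset_iff.2 hyG))
  have hK₂ : coloops M G ⊆ G \ {x, y} := by rw [hKempty]; exact Finset.empty_subset _
  refine localShadowHall_excess_of_count (d := 3) (ρ := 6) (m₁ := 2) hG hd (by norm_num) hk' (by norm_num)
    hs hl hc2 hm2 (E := (41 / 120 : ℚ)) (by norm_num) ?_ (cnt := cntTriangle 6) ?_ ?_ ?_
  · intro S _ T hT
    have hT' : T ∈ (S \ coloops M G).powersetCard 6 := by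
      unfold coverBases at hT
      exact (Finset.mem_filter.1 hT).1
    have h := sum_faceLoss_union_le (a := (1 / 4 : ℚ)) (b := (1 / 40 : ℚ)) hG hd (by norm_num) hk' (by omega)
      hs hl (by norm_num) (by rw [hnK]; intro m h1 h2; exact DGenP.chord_three_zero_10 m h1 (by omega))
      (by rw [hnK, hk, DGenP.excessBound_three_zero_10]; norm_num) hT'
    rw [hnK, hk, DGenP.excessBound_three_zero_10] at h
    exact h
  · intro s h1 h2
    rw [hn'] at h2
    exact cntTriangle_six_pos s h1 (by omega)
  · intro S hSG
    exact card_coverBases_le_cntTriangle hk' (by norm_num) (coloops_subset_clF_of_mem_thinMembers hG hd' hB₀)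
      hH₀ (coloops_subset_clF_of_mem_thinMembers hG hd' hB₁) hH₁ hK₂ hH₂ hP₀ hP₁ hP₂ hpx hpy hxy hSG
  · rw [hn', hk]
    exact countSum_three_zero_ten_tri

open scoped Classical in
/-- Three fat thin closures give three fat thin members missing pairwise DIFFERENT sets. -/
theorem exists_threeFat_of_two_lt_card_fatClosures {q : ℕ} {G : Finset α}
    (h : 2 < (fatClosures M q G 2).card) :
    ∃ B₀ ∈ thinMembers M q G, ∃ B₁ ∈ thinMembers M q G, ∃ B₂ ∈ thinMembers M q G,
      (G \ clF M B₀).card ≤ 2 ∧ (G \ clF M B₁).card ≤ 2 ∧ (G \ clF M B₂).card ≤ 2 ∧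
      G \ clF M B₀ ≠ G \ clF M B₁ ∧ G \ clF M B₀ ≠ G \ clF M B₂ ∧ G \ clF M B₁ ≠ G \ clF M B₂ := by
  rw [Finset.two_lt_card] at h
  obtain ⟨H₀, hH₀, H₁, hH₁, H₂, hH₂, h01, h02, h12⟩ := h
  unfold fatClosures at hH₀ hH₁ hH₂
  rw [Finset.mem_image] at hH₀ hH₁ hH₂
  obtain ⟨B₀, hB₀, rfl⟩ := hH₀
  obtain ⟨B₁, hB₁, rfl⟩ := hH₁
  obtain ⟨B₂, hB₂, rfl⟩ := hH₂
  rw [Finset.mem_filter] at hB₀ hB₁ hB₂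
  have hsub : ∀ {B : Finset α}, B ∈ thinMembers M q G → clF M B ⊆ G :=
    fun hB => (mem_membersIn.1 (mem_thinMembers.1 hB).1).2
  refine ⟨B₀, hB₀.1, B₁, hB₁.1, B₂, hB₂.1, hB₀.2, hB₁.2, hB₂.2, ?_, ?_, ?_⟩
  · intro heq; apply h01
    rw [← Finset.sdiff_sdiff_eq_self (hsub hB₀.1), heq, Finset.sdiff_sdiff_eq_self (hsub hB₁.1)]
  · intro heq; apply h02
    rw [← Finset.sdiff_sdiff_eq_self (hsub hB₀.1), heq, Finset.sdiff_sdiff_eq_self (hsub hB₂.1)]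
  · intro heq; apply h12
    rw [← Finset.sdiff_sdiff_eq_self (hsub hB₁.1), heq, Finset.sdiff_sdiff_eq_self (hsub hB₂.1)]

open scoped Classical in
/-- **THE CELL `(3, 0)` AT `|G| = 10` CLOSES OUTRIGHT** (given a fat thin member). -/
theorem localShadowHall_three_zero_six_ten {G : Finset α} (hG : G ∈ flatsQ M (5 + 1))
    (hd : (gr M \ G).card = 3) (hk : kColoops M G = 0)
    (hs : ∀ e ∈ gr M, ∀ f ∈ gr M, e ≠ f → rkN M {e, f} = 2) (hl : ∀ e ∈ gr M, M.Indep {e})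
    (hn : G.card = 10) {B₀ : Finset α} (hB₀ : B₀ ∈ thinMembers M 5 G) (hfat : (G \ clF M B₀).card ≤ 2) :
    LocalShadowHall M 5 G := by
  have hd' : (gr M \ G).card ≤ 5 := by omega
  by_cases h4 : (fatClosures M 5 G 2).card ≤ 4
  · by_cases h1 : (fatClosures M 5 G 2).card ≤ 1
    · exact localShadowHall_three_zero_six_ten_of_oneFatClosure hG hd hk hs hl hn hB₀ hfat h1
    · push Not at h1
      obtain ⟨B₀', hB₀', B₁, hB₁, hf₀, hf₁, hne⟩ := exists_twoFat_of_one_lt_card_fatClosures h1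
      exact localShadowHall_three_zero_six_ten_of_twoFat_b4 hG hd hk hs hl hn hB₀' hB₁ hf₀ hf₁ hne h4
  · push Not at h4
    obtain ⟨B₀', hB₀', B₁, hB₁, B₂, hB₂, hf₀, hf₁, hf₂, h01, h02, h12⟩ :=
      exists_threeFat_of_two_lt_card_fatClosures (M := M) (q := 5) (G := G) (by omega)
    -- every fat missed set has exactly two points
    have hc : ∀ {B : Finset α}, B ∈ thinMembers M 5 G → (G \ clF M B).card ≤ 2 → (G \ clF M B).card = 2 :=
      fun hB hle => le_antisymm hle
        (two_le_card_sdiff_of_not_lay0 hG hd' (mem_thinMembers.1 hB).1 (mem_thinMembers.1 hB).2)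
    by_cases hshare : ((G \ clF M B₀') ∩ (G \ clF M B₁)).Nonempty ∨ ((G \ clF M B₀') ∩ (G \ clF M B₂)).Nonempty ∨
        ((G \ clF M B₁) ∩ (G \ clF M B₂)).Nonempty
    · rcases hshare with ⟨p, hp⟩ | ⟨p, hp⟩ | ⟨p, hp⟩
      · obtain ⟨x, y, hP₀, hP₁, hpx, hpy, hxy⟩ := pair_shape_of_mem_inter (hc hB₀' hf₀) (hc hB₁ hf₁) h01 hp
        exact localShadowHall_three_zero_six_ten_of_triangle hG hd hk hs hl hn hB₀' hB₁ hP₀ hP₁ hpx hpy hxy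
      · obtain ⟨x, y, hP₀, hP₁, hpx, hpy, hxy⟩ := pair_shape_of_mem_inter (hc hB₀' hf₀) (hc hB₂ hf₂) h02 hp
        exact localShadowHall_three_zero_six_ten_of_triangle hG hd hk hs hl hn hB₀' hB₂ hP₀ hP₁ hpx hpy hxy
      · obtain ⟨x, y, hP₀, hP₁, hpx, hpy, hxy⟩ := pair_shape_of_mem_inter (hc hB₁ hf₁) (hc hB₂ hf₂) h12 hp
        exact localShadowHall_three_zero_six_ten_of_triangle hG hd hk hs hl hn hB₁ hB₂ hP₀ hP₁ hpx hpy hxy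
    · push Not at hshare
      obtain ⟨hd₀₁, hd₀₂, hd₁₂⟩ := hshare
      exact localShadowHall_three_zero_six_ten_of_threeDisjoint hG hd hk hs hl hn hB₀' hB₁ hB₂ hf₀ hf₁ hf₂
        hd₀₁ hd₀₂ hd₁₂

section SevenFiveN

variable {α' : Type} [DecidableEq α']

/-- **THE `(7, 5)` SHADOW ROW FOR EVERY FINITE MATROID MODULO THE RESIDUES N**: the residues M with the `(3, 0)`
range shrunk to `11 ≤ |G| ≤ 12` — the cells `(3, 0)` at `|G| = 10` and `|G| = 13` are closed outright. -/
theorem shadowHall_seven_five_of_residuesN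
    (h20 : ∀ (N : Matroid α') [N.Finite] (G : Finset α'), CellHyp N G →
      (gr N \ G).card = 2 → kColoops N G = 0 → FatMember N G 6 3 →
      (FatBasis N G 6 2 ∨ FatMember N G 6 2) → LocalShadowHall N 5 G)
    (h21 : ∀ (N : Matroid α') [N.Finite] (G : Finset α'), CellHyp N G →
      (gr N \ G).card = 2 → kColoops N G = 1 → FatMember N G 5 4 →
      (FatBasis N G 5 3 ∨ FatMember N G 5 3) → LocalShadowHall N 5 G)
    (h30 : ∀ (N : Matroid α') [N.Finite] (G : Finset α'), CellHyp N G →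
      (gr N \ G).card = 3 → kColoops N G = 0 → 11 ≤ G.card → G.card ≤ 12 → FatMember N G 6 2 →
      FatBasis N G 6 2 → (G.card = 12 → NoThreeDisjointFat N G 2) → (G.card = 11 → NoFourDisjointFat N G 2) →
      (G.card = 11 → 3 ≤ (fatClosures N 5 G 2).card) → (G.card = 12 → 4 ≤ (fatClosures N 5 G 2).card) →
      LocalShadowHall N 5 G)
    (h31 : ∀ (N : Matroid α') [N.Finite] (G : Finset α'), CellHyp N G →
      (gr N \ G).card = 3 → kColoops N G = 1 → 11 ≤ G.card → G.card ≤ 17 → FatMember N G 5 2 →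
      (G.card = 17 → FatBasis N G 5 2) → (G.card = 17 → NestedFat N G 2 3) →
      (G.card = 16 → MeetingFat N G 2) → (11 ≤ G.card ∧ G.card ≤ 17 → NoThreeDisjointFat N G 2) →
      (G.card = 11 ∨ G.card = 15 ∨ G.card = 16 → FatBasis N G 5 3) →
      (12 ≤ G.card ∧ G.card ≤ 14 → FatBasis N G 5 4) → LocalShadowHall N 5 G)
    (h32 : ∀ (N : Matroid α') [N.Finite] (G : Finset α'), CellHyp N G →
      (gr N \ G).card = 3 → kColoops N G = 2 → FatMember N G 4 2 → LocalShadowHall N 5 G)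
    (M : Matroid α') [M.Finite] : ShadowHall M 7 5 (phiK 7 5) := by
  apply shadowHall_seven_five_of_residuesM h20 h21 _ h31 h32
  intro N _ G hcell hd hk h10 h12 hfm hfb hnd3 hnd4 hc10 hc11 hc12
  by_cases hG10 : G.card = 10
  · obtain ⟨B₀, hB₀, -, hfat⟩ := hfm
    exact localShadowHall_three_zero_six_ten hcell.2.2.2 hd hk hcell.1 hcell.2.1 hG10 hB₀ hfat
  · exact h30 N G hcell hd hk (by omega) h12 hfm hfb (fun h => hnd3 (Or.inr h)) hnd4 hc11 hc12

end SevenFiveN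

end PercRepro.Shadow
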